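import Summits.NavierStokesRegularity.NavierStokesRegularity.Theses.FilamentSkeletonRss
import Summits.NavierStokesRegularity.NavierStokesRegularity.Theorems.FilamentSkeletonRssCoreGluingVacuous
import Summits.NavierStokesRegularity.NavierStokesRegularity.Theorems.FilamentSkeletonRssCoreGluingWallReduction

/-!
# Route `FilamentSkeletonRss` · crux `CoreGluing` (stmt-NavierStokesRegularity-15401) — the rev-5 invertibility split

Line `invertibility-split`, lead c12 (2026-08-17).  Route rev 5 (judge repair, 08:59Z) re-cut the crux
`CoreGluing := SkeletonEquilibrium → RssProfileExists` at route level into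

* `CoreLinearInvertibility` (stmt-NavierStokesRegularity-17973): the uniform-in-circulation a priori
  bound for the linearised strained planar core operator `L_λ − RΛ_G` in `L²(G_λ⁻¹)` modulo mass and
  first moments (Gallay–Wayne / Maekawa), and
* `CoreGluingGivenInvertibility` (stmt-NavierStokesRegularity-17944) `:= CoreLinearInvertibility → CoreGluing`,

and the deciding theorem `closes` now binds these two instead of `CoreGluing`.  This file is the
bookkeeping of that split for THIS item:

* `coreGluing_of_invertibility_split` — the composition (modus ponens): the crux closes the moment both
  children land (it is `CoreGluing_of` of the registered skeleton `Cruxes/CoreGluing/Lines/invertibility_split.lean`);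
* the child `CoreGluingGivenInvertibility` inherits the parent's logical shape verbatim:
  it is `CoreLinearInvertibility → (¬ SkeletonEquilibrium ∨ RssProfileExists)`
  (`coreGluingGivenInvertibility_iff`), holds vacuously from `¬ SkeletonEquilibrium`
  (`coreGluingGivenInvertibility_of_not_skeletonEquilibrium`) or from the target, is EQUIVALENT to the
  parent once the linear input holds (`coreGluing_iff_coreGluingGivenInvertibility`), and under the
  Type-I DSS Liouville wall plus the linear input it is literally `¬ SkeletonEquilibrium`
  (`coreGluingGivenInvertibility_iff_not_skeletonEquilibrium_of_wall`) — so the rev-5 split isolates the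
  provable linear lemma but does NOT repair the idle skeleton hypothesis: a gluing theorem needs the
  quantitative ball-box form of the skeleton (`Cruxes/CoreGluing/SPLIT-s1.md`, child `SelectionBox`).
Registered tools stub: `stub_invertibilitySplitTools`.
-/

set_option linter.dupNamespace false

namespace Summit.NavierStokesRegularity.NavierStokesRegularity.Theorems

open Summit.NavierStokesRegularity.NavierStokesRegularity.Theses.FilamentSkeletonRss

/-- **The rev-5 composition.**  `CoreLinearInvertibility → CoreGluingGivenInvertibility → CoreGluing`
(modus ponens; this is `CoreGluing_of` of the registered skeleton of line `invertibility-split`). [folklore] -/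
theorem coreGluing_of_invertibility_split (hL : CoreLinearInvertibility)
    (hK2 : CoreGluingGivenInvertibility) : CoreGluing :=
  hK2 hL

/-- The parent implies the child: `CoreGluing → CoreGluingGivenInvertibility`. [folklore] -/
theorem coreGluingGivenInvertibility_of_coreGluing (h : CoreGluing) : CoreGluingGivenInvertibility :=
  fun _ => h

/-- **Given the linear input, parent and child coincide.** [folklore] -/
theorem coreGluing_iff_coreGluingGivenInvertibility (hL : CoreLinearInvertibility) :
    CoreGluing ↔ CoreGluingGivenInvertibility :=
  ⟨coreGluingGivenInvertibility_of_coreGluing, fun hK2 => hK2 hL⟩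

/-- **Vacuous branch of the child.**  If the skeleton statement is refuted (stmt-15400's negation line),
`CoreGluingGivenInvertibility` holds with neither hypothesis consumed. [folklore] -/
theorem coreGluingGivenInvertibility_of_not_skeletonEquilibrium (h : ¬ SkeletonEquilibrium) :
    CoreGluingGivenInvertibility :=
  fun _ => coreGluing_of_not_skeletonEquilibrium h

/-- **Target branch of the child.**  The route target alone gives `CoreGluingGivenInvertibility`. [folklore] -/
theorem coreGluingGivenInvertibility_of_rssProfileExists (h : RssProfileExists) :
    CoreGluingGivenInvertibility :=
  fun _ _ => h

/-- **Logical shape of the child.**  `CoreGluingGivenInvertibility` is exactly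
`CoreLinearInvertibility → (¬ SkeletonEquilibrium ∨ RssProfileExists)`: the linear lemma only guards the
same material implication as the parent crux. [folklore] -/
theorem coreGluingGivenInvertibility_iff :
    CoreGluingGivenInvertibility ↔ (CoreLinearInvertibility → (¬ SkeletonEquilibrium ∨ RssProfileExists)) := by
  unfold CoreGluingGivenInvertibility
  rw [coreGluing_iff_not_skeletonEquilibrium_or_rssProfileExists]

/-- **Refutation shape of the child.**  `¬ CoreGluingGivenInvertibility` is the conjunction: the linear
lemma holds, the skeleton theorem holds as typed, and the RSS Liouville statement holds in the window. [folklore] -/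
theorem not_coreGluingGivenInvertibility_iff :
    ¬ CoreGluingGivenInvertibility ↔ (CoreLinearInvertibility ∧ SkeletonEquilibrium ∧ ¬ RssProfileExists) := by
  rw [coreGluingGivenInvertibility_iff]
  constructor
  · intro h
    by_contra hc
    exact h fun hL => by
      by_cases hK1 : SkeletonEquilibrium
      · by_cases hR : RssProfileExists
        · exact Or.inr hR
        · exact absurd ⟨hL, hK1, hR⟩ hc
      · exact Or.inl hK1
  · rintro ⟨hL, hK1, hR⟩ h
    rcases h hL with h1 | h2
    · exact h1 hK1
    · exact hR h2

/-- **Under the wall and the linear input, the child is the negation of the sibling crux.**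
`TypeIDSSLiouvilleConjecture → CoreLinearInvertibility → (CoreGluingGivenInvertibility ↔ ¬ SkeletonEquilibrium)`. [folklore] -/
theorem coreGluingGivenInvertibility_iff_not_skeletonEquilibrium_of_wall
    (hW : Summit.NavierStokesRegularity.NavierStokesRegularity.TypeIDSSLiouvilleConjecture)
    (hL : CoreLinearInvertibility) :
    CoreGluingGivenInvertibility ↔ ¬ SkeletonEquilibrium := by
  rw [← coreGluing_iff_coreGluingGivenInvertibility hL]
  exact coreGluing_iff_not_skeletonEquilibrium_of_wall hW

/-- **Under the wall, the rev-5 route cannot have all its cruxes**: `SkeletonEquilibrium`,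
`CoreLinearInvertibility` and `CoreGluingGivenInvertibility` together give the target, which refutes the
Type-I DSS Liouville conjecture. [folklore] -/
theorem not_all_rev5_cruxes_of_wall
    (hW : Summit.NavierStokesRegularity.NavierStokesRegularity.TypeIDSSLiouvilleConjecture) :
    ¬ (SkeletonEquilibrium ∧ CoreLinearInvertibility ∧ CoreGluingGivenInvertibility) :=
  fun h => not_rssProfileExists_of_wall hW (h.2.2 h.2.1 h.1)

/-- Registered tools stub of crux stmt-NavierStokesRegularity-15401 (`ledger workitem stub-add … --name
stub_invertibilitySplitTools`): the rev-5 split bookkeeping of this file — composition, parent/child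
equivalence given the linear input, the child's logical shape, and its wall reduction. [folklore] -/
theorem stub_invertibilitySplitTools :
    (Summit.NavierStokesRegularity.NavierStokesRegularity.Theses.FilamentSkeletonRss.CoreLinearInvertibility → Summit.NavierStokesRegularity.NavierStokesRegularity.Theses.FilamentSkeletonRss.CoreGluingGivenInvertibility → Summit.NavierStokesRegularity.NavierStokesRegularity.Theses.FilamentSkeletonRss.CoreGluing) ∧ (Summit.NavierStokesRegularity.NavierStokesRegularity.Theses.FilamentSkeletonRss.CoreLinearInvertibility → (Summit.NavierStokesRegularity.NavierStokesRegularity.Theses.FilamentSkeletonRss.CoreGluing ↔ Summit.NavierStokesRegularity.NavierStokesRegularity.Theses.FilamentSkeletonRss.CoreGluingGivenInvertibility)) ∧ (Summit.NavierStokesRegularity.NavierStokesRegularity.Theses.FilamentSkeletonRss.CoreGluingGivenInvertibility ↔ (Summit.NavierStokesRegularity.NavierStokesRegularity.Theses.FilamentSkeletonRss.CoreLinearInvertibility → (¬ Summit.NavierStokesRegularity.NavierStokesRegularity.Theses.FilamentSkeletonRss.SkeletonEquilibrium ∨ Summit.NavierStokesRegularity.NavierStokesRegularity.Theses.FilamentSkeletonRss.RssProfileExists)))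 ∧ (Summit.NavierStokesRegularity.NavierStokesRegularity.TypeIDSSLiouvilleConjecture → Summit.NavierStokesRegularity.NavierStokesRegularity.Theses.FilamentSkeletonRss.CoreLinearInvertibility → (Summit.NavierStokesRegularity.NavierStokesRegularity.Theses.FilamentSkeletonRss.CoreGluingGivenInvertibility ↔ ¬ Summit.NavierStokesRegularity.NavierStokesRegularity.Theses.FilamentSkeletonRss.SkeletonEquilibrium)) :=
  ⟨coreGluing_of_invertibility_split, coreGluing_iff_coreGluingGivenInvertibility,
    coreGluingGivenInvertibility_iff, coreGluingGivenInvertibility_iff_not_skeletonEquilibrium_of_wall⟩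

end Summit.NavierStokesRegularity.NavierStokesRegularity.Theorems
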